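import Literature.AlgebraicGeometry.HodgeTheory.WeilClassesBlochSeed
import Literature.AlgebraicGeometry.HodgeTheory.WeilClassesLocalTensorAnchor
import Literature.AlgebraicGeometry.HodgeTheory.WeilClassesRationalPlane
import Literature.AlgebraicGeometry.HodgeTheory.WeilFamilyBalanced
import Literature.AlgebraicGeometry.HodgeTheory.RelativeHyperplaneClassHodgeRiemann
import Literature.AlgebraicGeometry.HodgeTheory.HypersurfaceLefschetzProofs
import Literature.AlgebraicGeometry.HodgeTheory.AlgebraicClassesHodgeTypeHolds
import Literature.AlgebraicGeometry.HodgeTheory.FubiniStudyClassRational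
import HarnessLib

/-!
# Bloch seeds at TENSOR points feed Deligne's family: the local tensor clause of the Weil ladder
# from Bloch's semiregularity theorem (Bloch 1972 / Buchweitz–Flenner 2003, class-level form in the tree)

Family `hodge`, layer `Literature/AlgebraicGeometry/HodgeTheory`. Requested by the B2b ladder `hodge-weil` (packet
`run/shared/lean/b2b/hodge-weil/`, `LADDER.md ## CARVER v5` C34, row "pv2": *type the DESIGN ⟹ GERM edge over the
tree's Bloch files*), seat prover 2 generation 5. ONE PREDICATE (real definition) and PROVED bridges; NOTHING is
asserted, no named fact is introduced.

Door T of the packet (`WeilClassesLocalTensorAnchor.lean` + `Summits/…/Theorems/WeilTypeLadderTensorLocalAnchor(All).lean`)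
reduces every open rung of Weil's question for `K = ℚ(√-p)` — all dimensions `2k`, all `p`, ALL discriminants — to the
refereed-source fact `deligne1982_weilFamily_hodgeWeilSection_all` (Deligne's PEL family THROUGH the target, with a
flat `(k,k)` Weil section and a TENSOR POINT `Y ~_K A₁ ⊗ ℤ[√-p]` on the same base) plus ONE un-printed local input,
`HasLocallyAlgebraicTensorAnchors k p` (TLOCAL): along every abelian-fibred `ℤ[√-p]`-family through a tensor point
`Y`, a global class `W` restricting to a rational Weil class `x` of `Y` is, up to `q·Hᵏ` for some global fibrewise
rational `(1,1)` class `H`, algebraic on the fibres over a neighbourhood of the tensor point. No reach statement, no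
Weil-similarity and no discriminant bookkeeping enter (contrast doors A / B′, fed by Bloch seeds in
`WeilClassesBlochSeed.lean`). This file types door T's feeder whose deformation theory is REFEREED and already in the
tree on real carriers — Bloch's semiregularity theorem in class-level form, `BlochSemiregularSpread (2k) k`
(`BlochSemiregularSpread.lean`: Bloch 1972 Thm. (7.4) / Remark (7.5) = Buchweitz–Flenner 2003 Thm. 5.2 at `I = {k}` =
Voisin, LNM 1594, Lecture 7, Thm. 2.4):

* `HasTensorBlochSeeds k p` (PREDICATE): for every tensor point `(Y, Ψ)` (the isogeny-pair clause of TLOCAL verbatim),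
  every NON-ZERO rational class `x` of its Weil plane, and every hyperplane-type class `h = ι^* a` (`ι : Y ↪ ℙᴺ` a
  projective embedding, `a ∈ H²(ℙᴺ(ℂ); ℂ)` rational and non-zero — the tree's idiom for "a rational multiple of a
  hyperplane class", as in `hodgeRiemann_degreeOne`, `HasHyperbolicBlochSeed`), a Bloch seed for `q·hᵏ + x` on `Y`
  (`HasBlochSeedAt k Y h x`: an INTEGRAL local complete intersection `Z ↪ Y` of codimension `k`, Bloch-semiregular,
  with `q·hᵏ + x` supported on `Z`). WHY EVERY HYPERPLANE-TYPE CLASS: TLOCAL quantifies over all families through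
  `Y`; Bloch's theorem needs the seed class `q·hᵏ + x` to be the restriction of a GLOBAL class, and the only global
  degree-2 classes an arbitrary quasi-projective family is known to carry are the hyperplane classes of its
  projective immersions (`exists_forall_isClosedImmersion_fiberι_comp`), whose restriction to the tensor fibre is a
  hyperplane-type class of SOME projective embedding of `Y` — not one we may choose. (Along Deligne's actual family the
  generic Néron–Severi group is `ℚ·h₀`, so only the component's own `K`-compatible polarization at `Y`, up to a positive
  rational multiple, is ever met; that sharpening needs the generic Mumford–Tate group and is NOT typed here.)
* `hasBlochSeedAt_zero_of_hasBlochSeedAt` (PROVED): a seed for `w` is a seed for `0` (same `Z`, `q = 0`).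
* `hasLocallyAlgebraicTensorAnchors_of_blochSpread_of_tensorBlochSeeds` (PROVED, `k, p ≥ 1`):
  **`BlochSemiregularSpread (2k) k ∧ HasTensorBlochSeeds k p ⟹ HasLocallyAlgebraicTensorAnchors k p`.** Proof: the
  family's total space is quasi-projective, hence immersed in some `ℙᵐ` by a preimmersion `ε` with every fibre
  `𝒳_s ↪ 𝒳 → ℙᵐ` a CLOSED immersion (`isClosedImmersion_fiberι_comp_left_of_isPreimmersion`); `m ≥ 1` because the
  `2k`-fold `Y ≅ 𝒳_{s₀}` is closed in `ℙᵐ` (`dim_le_of_isClosedImmersion_projectiveSpace`); take a non-zero rational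
  `a ∈ H²(ℙᵐ)` (`exists_isRationalClass_ne_zero_projectiveSpace`) and `H := ε^* a` — fibrewise rational
  (`IsRationalClass.map`) and of type `(1,1)` (restricted from projective space, hence algebraic,
  `map_projectiveSpace_mem_algebraicClasses`, hence `(1,1)`, `isOfHodgeType_of_mem_algebraicClasses_of_isSmoothProjective`);
  the seed at the tensor point for `h = (e₀ ≫ ι_{s₀} ≫ ε)^* a` (for `x = 0`: the seed of some non-zero rational Weil
  class, `exists_isRationalClass_ne_zero_mem_weilClassesOf`, with `q = 0`); then the global class `B := q·Hᵏ + W` is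
  fibrewise rational of type `(k,k)` and `e₀^*(B|_{s₀}) = q·hᵏ + x` is the seed's supported class, so Bloch's theorem
  gives the open neighbourhood — exactly the argument of `weilAnchorLocalClause_of_blochSpread_of_blochSeedAt`
  (`WeilClassesBlochSeed.lean`) with `H` manufactured from the immersion instead of supplied by a reach fact.
* `hasLocallyAlgebraicTensorAnchors_of_forall_mem_algebraicClasses` (sanity): under the `(2k, k)` slice of the Hodge
  conjecture the local tensor clause holds outright — the transport input is on-path, the seed input is not.

Summit-side consumers (`Summits/HodgeConjecture/HodgeConjecture/Theorems/WeilTypeLadderTensorBlochSeed.lean`, this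
seat): **stmt-HodgeConjecture-2524 (ALL `√-d`-Weil sixfolds), R1′, R∞, the cruxes `WeilSixfoldsSqrtMinus7` /
`WeilTenfoldsSqrtMinus11` ⟸ Deligne's fact ∧ `BlochSemiregularSpread (2k) k` ∧ `HasTensorBlochSeeds k d`** — both
transport inputs REFEREED (Deligne 1982; Bloch 1972 / Buchweitz–Flenner 2003), the seed predicate the one DESIGN input.

HONEST FRAMING. `HasTensorBlochSeeds` is NOT implied by the Hodge conjecture and carries no on-path lemma (Bloch,
Remark (7.5): "The problem of constructing semi-regular representatives for algebraic cycle classes of codimension `> 1`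
remains, however, wide open"); it is a design input, exactly like `HasBlochSeedAt`. What a tensor seed may NOT be is
recorded in the module docstring of `WeilClassesBlochSeed.lean` and in the packet (`LADDER.md ## CARVER v5` C33 (c),
C36; `b2b-hweil-pv2-g4/BLOCH-SEEDS.md` §4): single sub-tori, galleries, disconnected unions, divisor complete
intersections and split sums of graph sheaves are excluded at tensor points; the Weil class at the CM square
`E_K^k(ι) × E_K^k(ῑ)` is an explicit cubic (for `k = 3`) in graph-divisor classes with MIXED signs over abelian
sub-threefolds (C36 (ii)), and `hᵏ ⌣ x = 0` (`cupProduct_cupPowTwo_eq_zero_of_map_eq_smul_of_mem_weilClassesOf`) forces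
`q ≠ 0` for every effective seed. Rungs of the ladder proved unconditionally above the floor: still 0.

## References
* [Bloch1972Semiregularity] S. Bloch, Semi-regularity and de Rham cohomology, Invent. Math. 17 (1972) 51–66, Thm. (7.4)
  and Remark (7.5).
* [BuchweitzFlenner2003] R.-O. Buchweitz, H. Flenner, A semiregularity map for modules and applications to deformations,
  Compositio Math. 137 (2003) 135–210, Thm. 5.2, (8.1), Prop. 8.2.
* [VoisinTorino1994] C. Voisin, Transcendental methods in the study of algebraic cycles, LNM 1594, Lecture 7, Thm. 2.4.
* [Deligne1982HodgeCycles] P. Deligne, Hodge cycles on abelian varieties, LNM 900 (1982), proof of Thm. 4.8 (a)–(c)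
  (the family and its tensor point).
* [vanGeemen1994HodgeAV] B. van Geemen, An introduction to the Hodge conjecture for abelian varieties, LNM 1594 (1994),
  5.3–5.7 (the family in every component), 6.12 (generic Hodge ring `B• = ℚ[h] ⊕ W`).
* [Hartshorne1977] R. Hartshorne, Algebraic Geometry, II §4 (proper immersions are closed; fibres of projective
  families).
* [VoisinHodgeII2003] C. Voisin, Hodge Theory and Complex Algebraic Geometry II, §1.2.3 Cor. 1.24 (classes restricted
  from projective space are algebraic).
-/

noncomputable section

open CategoryTheory AlgebraicGeometry

namespace Literature.AlgebraicGeometry.HodgeTheory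

open Literature.AlgebraicTopology.SingularHomology Literature.AlgebraicGeometry.Motives

section HodgeTheory

/-! ### The seed predicate at tensor points -/

/-- **Bloch seeds at tensor points, dimension `2k`, `K = ℚ(√-p)`** (PREDICATE, nothing asserted; a DESIGN input with no
on-path lemma). For EVERY complex abelian `2k`-fold `(Y, Ψ)` with `Ψ ≫ Ψ = -p` carrying an isogeny pair towards a
tensor point `(A₁ × A₁, Ψ₀)`, `Ψ₀ = prodLift (snd ≫ (-p)) fst` (the clause of `HasLocallyAlgebraicTensorAnchors k p`
VERBATIM), every NON-ZERO RATIONAL class `x` of `weilClassesOf Y Ψ k p`, every projective embedding `ι : Y ↪ ℙᴺ` and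
every non-zero rational `a ∈ H²(ℙᴺ(ℂ); ℂ)`: a Bloch seed for the class `q·(ι^*a)ᵏ + x` on `Y` (`HasBlochSeedAt`: an
integral local complete intersection `Z ↪ Y` of codimension `k`, Bloch-semiregular, `q ∈ ℚ`, `q·hᵏ + x` supported
on `Z` — Bloch, Remark (7.5): "there exist integers `a, b`, `a ≠ 0`, such that `a z₀ + b l₀^p` is the class of a
subscheme `Z₀ ⊂ X₀` which is semi-regular and a local complete intersection", for `z₀ = x`, `l₀ = ι^*a`). Module
docstring: why every hyperplane-type class, and what a seed may not be.
[cite: Bloch1972Semiregularity, Thm. (7.4) and Remark (7.5)] [cite: BuchweitzFlenner2003, Thm. 5.2 and (8.1)]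
[cite: Deligne1982HodgeCycles, proof of Thm. 4.8 (b)–(c) (the tensor point)] -/
def HasTensorBlochSeeds (k p : ℕ) : Prop :=
  ∀ (Y : Motives.AbelianVariety ℂ) (Ψ : Y ⟶ Y), Y.dim = 2 * k → Ψ ≫ Ψ = -((p : ℤ) • 𝟙 Y) →
    (∃ (A₁ : Motives.AbelianVariety ℂ) (f₁ : Y ⟶ A₁.prod A₁) (g₁ : A₁.prod A₁ ⟶ Y) (m : ℕ),
      A₁.dim = k ∧ 0 < m ∧ f₁ ≫ g₁ = m • 𝟙 Y ∧ AlgebraicGeometry.Flat f₁.hom.hom.hom.left ∧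
      g₁ ≫ Ψ = Motives.AbelianVariety.prodLift
        (Motives.AbelianVariety.snd A₁ A₁ ≫ (-((p : ℤ) • 𝟙 A₁))) (Motives.AbelianVariety.fst A₁ A₁) ≫ g₁) →
    ∀ (x : complexBetti Y.X (2 * k)), x ∈ weilClassesOf Y Ψ k p → IsRationalClass x → x ≠ 0 →
    ∀ (emb : Motives.ProjectiveEmbedding Y.X) (a : complexBetti (Motives.projectiveSpace emb.n ℂ) 2),
      IsRationalClass a → a ≠ 0 → HasBlochSeedAt k Y (complexBetti.map emb.ι 2 a) x

/-- **A Bloch seed for `w` is a Bloch seed for `0`** (same subscheme, `q = 0`: the class `0` is supported everywhere).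
Used to serve the degenerate instance `x = 0` of the local tensor clause from the seed of any non-zero class.
[cite: Bloch1972Semiregularity, Remark (7.5)] -/
theorem hasBlochSeedAt_zero_of_hasBlochSeedAt {k : ℕ} {P : Motives.AbelianVariety ℂ} {h : complexBetti P.X 2}
    {w : complexBetti P.X (2 * k)} (hS : HasBlochSeedAt k P h w) : HasBlochSeedAt k P h 0 := by
  obtain ⟨Z, i, _, hi, hreg, hint, hcoh, hsr, _⟩ := hS
  refine ⟨Z, i, 0, hi, hreg, hint, hcoh, hsr, ?_⟩
  rw [Rat.cast_zero, zero_smul, zero_add]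
  exact Submodule.zero_mem _

/-! ### The bridge: Bloch's theorem (class level) ∧ tensor seeds ⟹ the local tensor clause -/

/-- **Door T fed by Bloch seeds: `BlochSemiregularSpread (2k) k ∧ HasTensorBlochSeeds k p ⟹
HasLocallyAlgebraicTensorAnchors k p`** (`k, p ≥ 1`). Given a family `f : 𝒳 ⟶ S` of the clause through the tensor
point `Y ≅ 𝒳_{s₀}` and a global `W` with `e₀^*(W|_{s₀}) = x`: immerse the quasi-projective `𝒳` in some `ℙᵐ` by a
preimmersion `ε` (so that `𝒳_{s₀} ↪ 𝒳 → ℙᵐ` is a closed immersion and `m ≥ 2k ≥ 1`), take `a ∈ H²(ℙᵐ(ℂ); ℂ)` rational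
non-zero and `H := ε^* a` (fibrewise rational, and `(1,1)` because restricted from projective space, hence algebraic);
the tensor seed for `h := (e₀ ≫ ι_{s₀} ≫ ε)^* a = e₀^*(H|_{s₀})` and `x` (for `x = 0`: the seed of a non-zero rational
Weil class with `q = 0`) makes `B := q·Hᵏ + W` a global class, fibrewise rational of type `(k,k)`, whose restriction at
`s₀` is supported on a Bloch-semiregular integral local complete intersection of codimension `k`; Bloch's theorem
(class level) gives an open `U ∋ s₀` with `B|_s = q·H|_sᵏ + W|_s` algebraic for `s ∈ U`. The clause's hypotheses
"fibres abelian with an endomorphism of square `-p`" and "`S` irreducible" are not used (Bloch's theorem needs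
neither). [cite: Bloch1972Semiregularity, Thm. (7.4) and Remark (7.5)] [cite: BuchweitzFlenner2003, Thm. 5.2]
[cite: VoisinTorino1994, Lecture 7, Thm. 2.4] [cite: Hartshorne1977, II §4] -/
theorem hasLocallyAlgebraicTensorAnchors_of_blochSpread_of_tensorBlochSeeds {k p : ℕ} (hk : 0 < k) (hp : 0 < p)
    (hB : BlochSemiregularSpread (2 * k) k) (hT : HasTensorBlochSeeds k p) :
    HasLocallyAlgebraicTensorAnchors k p := by
  intro Y Ψ hY hΨ hpt x hxW hxr 𝒳 S f hf h𝒳 hS _ hsm _ W hW s₀ e₀ he₀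
  -- (1) an immersion of the total space in some `ℙᵐ`; the induced projective embedding of `Y`
  obtain ⟨P, j, ⟨m, κ, hκ⟩, hj⟩ := id h𝒳
  haveI := hκ
  haveI := hj
  set ε : 𝒳 ⟶ Motives.projectiveSpace m ℂ := j ≫ κ with hεdef
  haveI : IsPreimmersion ε.left := by
    rw [hεdef, Over.comp_left]
    infer_instance
  haveI : IsProper f.left := hf.isProper
  haveI : IsSeparated S.hom := hS.isSeparated
  haveI hcl : IsClosedImmersion (Motives.fiberι f s₀ ≫ ε).left :=
    isClosedImmersion_fiberι_comp_left_of_isPreimmersion f ε s₀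
  haveI : IsIso e₀.hom.left := (inferInstance : IsIso ((Over.forget _).mapIso e₀).hom)
  have hcl' : IsClosedImmersion (e₀.hom ≫ Motives.fiberι f s₀ ≫ ε).left := by
    rw [Over.comp_left]
    infer_instance
  let emb : Motives.ProjectiveEmbedding Y.X := ⟨m, e₀.hom ≫ Motives.fiberι f s₀ ≫ ε, hcl'⟩
  -- (2) `m ≥ 1`: the `2k`-fold `Y` is closed in `ℙᵐ`
  have hYsp : Motives.IsSmoothProjective Y.dim Y.X := Motives.AbelianVariety.isSmoothProjective_holds (A := Y)
  have hm : 1 ≤ m := by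
    obtain ⟨B⟩ := (nonempty_hodgeModel_holds (n := Y.dim) (X := Y.X)).nonempty hYsp
    obtain ⟨A⟩ := (nonempty_hodgeModel_holds (n := m) (X := Motives.projectiveSpace m ℂ)).nonempty
      (Motives.isSmoothProjective_projectiveSpace_holds ℂ m)
    have hle : Y.dim ≤ m := dim_le_of_isClosedImmersion_projectiveSpace hYsp emb.ι B A
    rw [hY] at hle
    omega
  -- (3) a non-zero rational `a ∈ H²(ℙᵐ)` and the global class `H := ε^* a`
  obtain ⟨a, ha, ha0⟩ := exists_isRationalClass_ne_zero_projectiveSpace hm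
  set H : complexBetti 𝒳 2 := complexBetti.map ε 2 a with hHdef
  have hHs : ∀ s : Motives.ComplexPoints S, complexBetti.map (Motives.fiberι f s) 2 H =
      complexBetti.map (Motives.fiberι f s ≫ ε) 2 a := by
    intro s
    rw [hHdef, complexBetti.map_comp (Motives.fiberι f s) ε 2, CategoryTheory.comp_apply]
  have hH : ∀ s : Motives.ComplexPoints S,
      IsRationalClass (complexBetti.map (Motives.fiberι f s) 2 H) ∧
        IsOfHodgeType (2 * k) (Motives.fiberOver f s) 2 1 1 (complexBetti.map (Motives.fiberι f s) 2 H) := by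
    intro s
    rw [hHs]
    refine ⟨ha.map _, ?_⟩
    have halg : complexBetti.map (Motives.fiberι f s ≫ ε) (2 * 1) a ∈ algebraicClasses (Motives.fiberOver f s) 1 :=
      map_projectiveSpace_mem_algebraicClasses (hf.isSmoothProjective s) _ 1 a
    exact isOfHodgeType_of_mem_algebraicClasses_of_isSmoothProjective (hf.isSmoothProjective s) 1 halg
  have hH₀ : complexBetti.map e₀.hom 2 (complexBetti.map (Motives.fiberι f s₀) 2 H) =
      complexBetti.map emb.ι 2 a := by
    rw [hHs, ← CategoryTheory.comp_apply, ← complexBetti.map_comp]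
  -- (4) a Bloch seed for `q·hᵏ + x` at the tensor point
  have hseed : HasBlochSeedAt k Y (complexBetti.map emb.ι 2 a) x := by
    by_cases hx0 : x = 0
    · have hΨ' : Ψ ≫ Ψ = -(p • 𝟙 Y) := by rw [hΨ, natCast_zsmul]
      obtain ⟨x₁, hx₁W, hx₁0, hx₁r⟩ := exists_isRationalClass_ne_zero_mem_weilClassesOf hk hY hp hΨ'
      rw [hx0]
      exact hasBlochSeedAt_zero_of_hasBlochSeedAt (hT Y Ψ hY hΨ hpt x₁ hx₁W hx₁r hx₁0 emb a ha ha0)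
    · exact hT Y Ψ hY hΨ hpt x hxW hxr hx0 emb a ha ha0
  -- (5) Bloch's theorem, class level, along the family, for the global class `B := q·Hᵏ + W`
  obtain ⟨Z, i, q, hi, hreg, hint, hcoh, hsr, hsupp⟩ := hseed
  set Bcl : complexBetti 𝒳 (2 * k) := ((q : ℚ) : ℂ) • cupPowTwo H k + W with hBdef
  have hres : ∀ s : Motives.ComplexPoints S, complexBetti.map (Motives.fiberι f s) (2 * k) Bcl =
      ((q : ℚ) : ℂ) • cupPowTwo (complexBetti.map (Motives.fiberι f s) 2 H) k +
        complexBetti.map (Motives.fiberι f s) (2 * k) W := by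
    intro s
    rw [hBdef, map_add, map_smul, complexBetti_map_cupPowTwo']
  have hBrat : ∀ s : Motives.ComplexPoints S,
      IsRationalClass (complexBetti.map (Motives.fiberι f s) (2 * k) Bcl) ∧
        IsOfHodgeType (2 * k) (Motives.fiberOver f s) (2 * k) k k
          (complexBetti.map (Motives.fiberι f s) (2 * k) Bcl) := by
    intro s
    rw [hres]
    exact ⟨(((hH s).1.cupPowTwo k).smul q).add (hW s).1,
      ((isOfHodgeType_cupPowTwo (hf.isSmoothProjective s) (hH s).2 k).smul _).add
        (hf.isSmoothProjective s) (hW s).2⟩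
  have hx : complexBetti.map e₀.hom (2 * k) (complexBetti.map (Motives.fiberι f s₀) (2 * k) Bcl) =
      ((q : ℚ) : ℂ) • cupPowTwo (complexBetti.map emb.ι 2 a) k + x := by
    rw [hres, map_add, map_smul, complexBetti_map_cupPowTwo', hH₀, he₀]
  obtain ⟨U, hUo, hs₀U, hU⟩ :=
    hB Y.X Z i _ 𝒳 S f s₀ e₀ Bcl hi hreg hint hcoh hsr hsupp hf h𝒳 hS hsm hBrat hx
  refine ⟨U, H, q, hUo, hs₀U, hH, fun s hs => ?_⟩
  rw [← hres]
  exact hU s hs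

/-! ### Sanity: the refereed input is on-path, the seed input is not -/

/-- **What the bridge consumes besides the seeds is a case of the Hodge conjecture**: the `(2k, k)` slice of HC gives
`BlochSemiregularSpread (2k) k` (`blochSemiregularSpread_two_mul_of_forall_mem_algebraicClasses`), and under that
slice the local tensor clause holds outright (`localTensorClause_of_forall_mem_algebraicClasses`) — so the seed
predicate is the only input of door T∘S that is not implied by the conjecture it serves (a DESIGN input: Bloch,
Remark (7.5)). [cite: Bloch1972Semiregularity, Remark (7.5)] [cite: Deligne2000, §1] -/
theorem hasLocallyAlgebraicTensorAnchors_of_forall_mem_algebraicClasses {k p : ℕ}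
    (h : ∀ ⦃X : Motives.SchemeOver ℂ⦄, Motives.IsSmoothProjective (2 * k) X → ∀ c : complexBetti X (2 * k),
      IsRationalClass c → IsOfHodgeType (2 * k) X (2 * k) k k c → c ∈ algebraicClasses X k) :
    HasLocallyAlgebraicTensorAnchors k p := by
  intro Y Ψ _ _ _ x _ _ 𝒳 S f hf _ _ _ _ _ W hW s₀ _ _
  exact localTensorClause_of_forall_mem_algebraicClasses f hf W s₀ fun s => h (hf.isSmoothProjective s) _ (hW s).1 (hW s).2

end HodgeTheory

end Literature.AlgebraicGeometry.HodgeTheory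

end
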